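import Summits.CriticalPhenomena.PercolationContinuityZ3.Theses.PercNearOneGluing
import Literature.Probability.Percolation.PercolationProofs

/-!
# `AdditiveGluing` (crux stmt-CriticalPhenomena-4576, route `PercNearOneGluing`):
# both hypotheses are load-bearing, the worst relay cannot be replaced by the average relay,
# and the degenerate gluing `o ∈ A` is the exact equality case (negative-side support, cdisprove seat)

`AdditiveGluing` claims: for every finite weighted graph (`prodBernoulli w` on `Set (Sym2 (Fin n))`),
every relay set `A`, vertices `o b` and slack `t`,
`0 ≤ t → (∀ a ∈ A, 1 − t ≤ P(a ↔ b)) → P(o ↔ A) − t ≤ P(o ↔ b)`.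

Here we record, sorry-free and with the statements written INLINE (no proposition is defined under
`Summits/`):

* `additiveGluing_false_without_nonneg` — dropping `0 ≤ t` is fatal, but only through the empty
  relay set (`A = ∅`, `t = −2`); for `A ≠ ∅` the relay hypothesis forces `t ≥ 0` by itself.
* `additiveGluing_false_without_relay` — dropping the relay hypothesis is fatal (two isolated
  vertices, `A = {o}`, `t = 0`: `1 ≤ 0`).
* `additiveGluing_false_with_average` — the natural 'linearised' strengthening in which
  `max_{a∈A} P(a ↮ b) ≤ t` is weakened to the AVERAGE `(∑_{a∈A} P(a ↮ b)) / |A| ≤ t` is FALSE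
  (two isolated vertices, `A = {o, b}`, `t = 1/2`): the worst relay alone must carry the bound.
* `additiveGluing_eq_of_mem` — if `o ∈ A` then `P(o ↔ A) = 1` and at the admissible slack
  `t = P(o ↮ b)` both sides coincide: the inequality is attained, so no uniform improvement
  `P(o ↔ A) − t + c ≤ P(o ↔ b)` with `c > 0` is possible (this is the `ratio = 1` family seen in all
  numerical sweeps).

Moral for provers: use both hypotheses; aim at the worst relay `a* = argmin P(a ↔ b)` (not an
average over `A`); and expect no slack beyond the degenerate gluing.  This file does NOT refute the
crux.
-/

noncomputable section


namespace Summit.CriticalPhenomena.PercolationContinuityZ3.Theorems.AdditiveGluing.Negative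

open MeasureTheory Set
open Literature.Probability.LatticeModels Literature.Probability.Percolation

/-- `{o ↔ o}` is the sure event. -/
theorem openConn_self_eq_univ {n : ℕ} (o : Fin n) :
    (openConn o o : Set (BondConfig (Fin n))) = univ := by
  ext ω; simp [openConn]

/-- In the empty configuration only the trivial connections hold. -/
theorem empty_mem_openConn_iff {n : ℕ} (x y : Fin n) :
    (∅ : BondConfig (Fin n)) ∈ openConn x y ↔ x = y := by
  simp [openConn, openGraph]

/-- All weights zero: the percolation measure is the point mass at the empty configuration. -/
theorem prodBernoulli_zero_eq_dirac {n : ℕ} :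
    prodBernoulli (fun _ : Sym2 (Fin n) => (0 : unitInterval)) = Measure.dirac ∅ := by
  rw [prodBernoulli_const]; exact ProbabilityTheory.setBernoulli_zero _

/-- Under zero weights `P(x ↔ y) = 1` if `x = y` and `0` otherwise. -/
theorem prodBernoulli_zero_real_openConn {n : ℕ} (x y : Fin n) :
    (prodBernoulli (fun _ : Sym2 (Fin n) => (0 : unitInterval))).real (openConn x y) =
      if x = y then 1 else 0 := by
  rw [prodBernoulli_zero_eq_dirac, measureReal_def,
    Measure.dirac_apply' _ (measurableSet_openConn_holds x y)]
  by_cases h : x = y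
  · simp [h, Set.indicator, (empty_mem_openConn_iff y y).2 rfl]
  · simp [h, Set.indicator, empty_mem_openConn_iff]

/-- If `o ∈ A` then `P(o ↔ A) = 1`. -/
theorem real_iUnion_openConn_eq_one_of_mem {n : ℕ} (w : Sym2 (Fin n) → unitInterval)
    {A : Finset (Fin n)} {o : Fin n} (ho : o ∈ A) :
    (prodBernoulli w).real (⋃ a ∈ A, openConn o a) = 1 := by
  have : (⋃ a ∈ A, (openConn o a : Set (BondConfig (Fin n)))) = univ := by
    apply Set.eq_univ_of_univ_subset
    rw [← openConn_self_eq_univ o]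
    exact Set.subset_iUnion₂ (s := fun a (_ : a ∈ A) => (openConn o a : Set (BondConfig (Fin n)))) o ho
  rw [this]; exact probReal_univ

/-- **`0 ≤ t` is load-bearing** (through `A = ∅` only): the crux with the hypothesis `0 ≤ t`
dropped is false — witness `n = 1`, `A = ∅`, `o = b = 0`, `t = −2`, where the relay hypothesis is
vacuous and the conclusion reads `0 + 2 ≤ P(o ↔ b) ≤ 1`. -/
theorem additiveGluing_false_without_nonneg :
    ¬ (∀ (n : ℕ) (w : Sym2 (Fin n) → unitInterval) (A : Finset (Fin n)) (o b : Fin n) (t : ℝ),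
        (∀ a ∈ A, 1 - t ≤ (prodBernoulli w).real (openConn a b)) →
          (prodBernoulli w).real (⋃ a ∈ A, openConn o a) - t ≤
            (prodBernoulli w).real (openConn o b)) := by
  intro h
  have h1 := h 1 (fun _ => 0) ∅ 0 0 (-2) (by simp)
  have h2 : (prodBernoulli (fun _ : Sym2 (Fin 1) => (0 : unitInterval))).real (openConn 0 0) ≤ 1 :=
    measureReal_le_one
  simp at h1
  linarith

/-- **The relay hypothesis is load-bearing**: the crux with `∀ a ∈ A, 1 − t ≤ P(a ↔ b)` dropped is
false — witness two vertices, all weights `0`, `A = {o}`, `b ≠ o`, `t = 0`, where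
`P(o ↔ A) − t = 1 > 0 = P(o ↔ b)`. -/
theorem additiveGluing_false_without_relay :
    ¬ (∀ (n : ℕ) (w : Sym2 (Fin n) → unitInterval) (A : Finset (Fin n)) (o b : Fin n) (t : ℝ),
        0 ≤ t → (prodBernoulli w).real (⋃ a ∈ A, openConn o a) - t ≤
          (prodBernoulli w).real (openConn o b)) := by
  intro h
  have h1 := h 2 (fun _ => 0) {0} 0 1 0 le_rfl
  rw [real_iUnion_openConn_eq_one_of_mem _ (Finset.mem_singleton_self 0),
    prodBernoulli_zero_real_openConn] at h1
  norm_num at h1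

/-- **The worst relay cannot be replaced by the average relay**: the strengthening of the crux in
which the hypothesis `max_{a∈A} P(a ↮ b) ≤ t` is weakened to `(∑_{a∈A} (1 − P(a ↔ b))) / |A| ≤ t`
is false — witness two isolated vertices `o = 0`, `b = 1`, `A = {0, 1}`: failures `1` and `0`,
average `1/2 =: t`, but `P(o ↔ A) − t = 1/2 > 0 = P(o ↔ b)`. -/
theorem additiveGluing_false_with_average :
    ¬ (∀ (n : ℕ) (w : Sym2 (Fin n) → unitInterval) (A : Finset (Fin n)) (o b : Fin n) (t : ℝ),
        0 ≤ t → (∑ a ∈ A, (1 - (prodBernoulli w).real (openConn a b))) / A.card ≤ t →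
          (prodBernoulli w).real (⋃ a ∈ A, openConn o a) - t ≤
            (prodBernoulli w).real (openConn o b)) := by
  intro h
  have h1 := h 2 (fun _ => 0) {0, 1} 0 1 (1 / 2) (by norm_num)
  rw [real_iUnion_openConn_eq_one_of_mem _ (by simp), Finset.sum_pair (by decide),
    prodBernoulli_zero_real_openConn, prodBernoulli_zero_real_openConn,
    Finset.card_pair (by decide)] at h1
  norm_num at h1

/-- **The degenerate gluing is the equality case**: if `o ∈ A` then `P(o ↔ A) = 1`, so at the slack
`t = P(o ↮ b)` (admissible exactly when `o` is the worst-connected relay) both sides of the crux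
coincide. Hence the constant in front of `t` cannot be lowered and no uniform gain is possible. -/
theorem additiveGluing_eq_of_mem {n : ℕ} (w : Sym2 (Fin n) → unitInterval) {A : Finset (Fin n)}
    {o : Fin n} (b : Fin n) (ho : o ∈ A) :
    (prodBernoulli w).real (⋃ a ∈ A, openConn o a) - (1 - (prodBernoulli w).real (openConn o b)) =
      (prodBernoulli w).real (openConn o b) := by
  rw [real_iUnion_openConn_eq_one_of_mem w ho]; ring

end Summit.CriticalPhenomena.PercolationContinuityZ3.Theorems.AdditiveGluing.Negative
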